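import Literature.MathematicalPhysics.QuantumFieldTheory.Balaban1983to89.B9Eq327GreenZd
import Literature.MathematicalPhysics.QuantumFieldTheory.Balaban1983to89.B9SupplySockB9P3ZdGenuineDpDRDs

/-!
# `Balaban1983to89.B9SupplySockB9P3ZdGenuineGop` — THE J-N06→N05 JUNCTION'S LETTER RECORD WITH THREE GENUINE LETTERS: `Δ′(U₀)` of
# [Balaban1985BackgroundPropagators] (3.10) (dag-n06-w2's `withDpZd`), `D R(U₀) D*` of (3.20)–(3.26) (dag-n06-w4's `opsLandau τ`) AND `G(U₀) = (Ω₀Δ_aΩ₀)⁻¹`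
# of (3.27) BUILT ON THEM (dag-n06-w4's `withGopZd`) — the composite `withGopZd (opsLandau τ (withDpZd ops₀))` carries `CurvAtInAk` ∧ `LandauAt` ∧
# `GopAddAt` as THEOREMS, and its `InvAt` follows from print's THEOREM 3.11 AT THE MEMBER IN PRINT'S OWN CURRENCY: «`Δ_a(U₀)` is positive definite on
# `E(Ω₀)`» (`⟨A, Δ_a(U₀)A⟩_τ > 0`), of whose four summands two are squares (`⟨A, D*DA⟩ ≥ 0`, `⟨A, D R D* A⟩ = ‖R D*A‖² ≥ 0`)

statement-level skeleton of published theorems with citation tags; proofs where landed; nothing here is a claim about the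
Yang–Mills mass gap

PDF held: `paper:balaban1985-cmp99-background-propagators` ([4] = B9; journal page = PDF page + 388), p. 392 (3.10), pp. 394–395 (3.20)–(3.27), p. 416
Thm 3.11: *«There exist constants M₀, α₀′ > 0 such that for M ≥ M₀, α₀ ≤ α₀′ and for U satisfying (3.35) the operators Δ′_a, G′, (Q′G′²Q′*)⁻¹, Δ_a, G are
positive definite … uniformly in U, Ω_j.»*; `paper:balaban1985-cmp99-regular-spaces-gauge-fixing` (B8) p. 86 (1.58) — quoted in the imported files, BY NAME.

WHY THIS FILE (cell `pub-ymgap`, HUMAN RULING D-0062 ∕ D-0149; seat `pub-ymgap-dag-n06-w4` (g2), node N06 = [B9]; count-neutral).  The junction's letter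
record `OpsZd` has four letters; three are now OBJECTS, each by a record edit of its own field: `withDpZd` (`Dp`, dag-n06-w2 p586146), `opsLandau τ` (`DRDs`,
this seat p585863) and `withGopZd` (`Gop`, this seat's `B9Eq327GreenZd` — the inverse of `Ω₀Δ_aΩ₀` built from the record's co-letters).  dag-n06-w2's
`B9SupplySockB9P3ZdGenuineDpDRDs` (p591866) stated the two-letter composite; THIS FILE states the three-letter composite — `G(U₀)` is then the inverse of
`Ω₀(D*D + Δ′ + D R D* + Q*aQ)Ω₀` with the GENUINE `Δ′` and `D R D*` and the consumer's `Q*aQ` letter — and proves what the object layer now gives: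
(a) the three object-borne binders at once, unconditionally; (b) `LinearOnDomAt` for the composite (the genuine `Δ′` and `D R(U₀) 𝟙_{Ω₀}D*` are ℝ-linear
in `A`; the `Q*aQ` letter's linearity is the one displayed hypothesis); (c) hence, by `B9Eq327GreenZd.regularAt_of_bondPair_pos`, the binder `InvAt` from
THEOREM 3.11 AT THE MEMBER stated in print's currency — positivity of `⟨A, Δ_a(U₀)A⟩_τ` on `E(Ω₀) ∖ 0` for `U₀` in the class (3.35) —; (d) the ledger of
that positivity: `⟨A, Δ_aA⟩ = ⟨A, D*DA⟩ + ⟨A, Δ′A⟩ + ‖R(U₀)𝟙_{Ω₀}D*A‖² + ⟨A, Q*aQA⟩` with the first and third `≥ 0` (this seat's p591149), so that what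
Theorem 3.11 must supply at the carrier is exactly the domination of the (small, unsigned) curvature term `⟨A, Δ′A⟩` ((3.69)) by the three others.

WHAT IS PROVED (0 sorry; definitions with bodies + theorems; no `instance`, no `notation`).
* §1 `opsGenuine τ ops₀ := withGopZd (opsLandau τ (withDpZd ops₀))`; field readings `opsGenuine_Dp ∕ _DRDs ∕ _QQ ∕ _Gop` (`rfl`); `restrictDom_deltaAOf_gopZd`
  (`G(U₀)` is also a RIGHT inverse on `Ω₀` in the regime: `Ω₀Δ_a(G J) = Ω₀J` — `A := G(U₀)J` solves `Δ_aA = J` on `Ω₀`, for any letter record) + `_opsGenuine_gop`.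
* §2 ★★ `curvAtInAk_opsGenuine` (`1 ≤ L`, `1 ≤ M`), ★★ `landauAt_opsGenuine` (finite `Ω₀`, the `τ`-hypotheses), ★★ `gopAddAt_opsGenuine` (no hypothesis),
  ★ `three_binders_opsGenuine` (the conjunction).
* §3 linearity of the genuine letters: `projR_add ∕ projR_smul` (the constructed `R(U₀)` is ℝ-linear on functions), ★ `opsLandau_DRDs_add ∕ _smul`
  (`D R(U₀) 𝟙_{Ω₀}D*` is ℝ-linear in `A` at members with finite `Ω₀`; private real-homogeneity helpers for `D^η`, `D^{η*}`, `Δ′`);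
  `QQLinearAt o U₀` (the displayed hypothesis: the record's `Q*aQ` letter at `U₀` is the restriction of an ℝ-linear map); ★★ `linearOnDomAt_opsGenuine`.
* §4 `PosDefInClassAt τ bg mem ιCfg ops c35 a₃ M i m` — **THEOREM 3.11 AT THE MEMBER IN PRINT'S CURRENCY**: for every unitary `U₀` of the member's class
  (3.35) with `0 < α₀`, `Mα₀ ≤ a₃` (the guards of `InvAt`) and every `0 ≠ A ∈ E(Ω₀)`, `0 < ⟨A, Δ_a(U₀)A⟩_τ` — a `Prop` the consumer supplies (NOT proved);
  ★★ `regularInClassAt_opsGenuine_of_posDef`; ★★★ `invAt_opsGenuine_of_posDef` — `InvAt bg L mem ιCfg (opsGenuine τ ops₀) c35 a₃ M i m` from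
  `PosDefInClassAt` + `QQLinearAt` at the class; ★ `all_object_binders_opsGenuine` (`CurvAtInAk ∧ LandauAt ∧ GopAddAt ∧ InvAt` under those two).
* §5 ★★ `bondPair_deltaAOf_opsGenuine_ge` (`⟨A, Δ_a(U₀)A⟩_τ ≥ ⟨A, Δ′(U₀)A⟩_τ + ⟨A, Q*aQ A⟩_τ` at a unitary background for `A ∈ E(Ω₀)` — the two
  squares `⟨A, D*DA⟩ ≥ 0` and `⟨A, D R 𝟙_{Ω₀}D* A⟩ ≥ 0` (p591149) dropped), and the reduction ★ `posDefInClassAt_opsGenuine_of_curv` (if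
  `⟨A, Δ′(U₀)A⟩_τ + ⟨A, Q*aQ A⟩_τ > 0` on `E(Ω₀) ∖ 0` across the class then `PosDefInClassAt` — the simplest sufficient form; print's Theorem 3.11 instead
  dominates the curvature term by all three others; bookkeeping only).
* §6 ★★ `sockB9P3D4γI_at_opsGenuine` — FOR THE CONSUMER: dag-n06-b's finite-`Ω₀` (margin road) supplier `sockB9P3D4γI_at` (p585159) for the composite, with
  the three letter-binders `InvAt ∕ CurvAtInAk ∕ LandauAt` REPLACED by §2 and §4: the knit supplies `DictAt`, `Prop6At`, `AvgAtγ`, `SeesDom`, Theorem 3.3's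
  block `h33U` — and Theorem 3.11's positivity `PosDefInClassAt` + the `Q*aQ` letter's linearity; `c69 := 14(d−1)`.

HONEST SCOPE.  Bookkeeping over p586146, p585863, p591149 and `B9Eq327GreenZd` (cited BY NAME; nothing re-proved); the one estimate that matters —
Theorem 3.11's domination of `⟨A, Δ′(U₀)A⟩` by `‖D A‖² + ‖R D*A‖² + ⟨A, Q*aQ A⟩` for `U₀` in the class (3.35) ([4] Sect. E, (3.110)–(3.116)) — is NOT
proved: it is N06's object-bound and stays the displayed hypothesis `PosDefInClassAt`; `Q*aQ` stays the consumer's letter (its linearity displayed);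
`AvgAt`, `HolderAt*`, `SrcAt*`, `DictAt` untouched.  A6: `PosDefInClassAt` is inhabited for the one-level record of `B9Eq327GreenZd` §5 (there), not
for `opsGenuine` at `m ≥ 1` (that IS Theorem 3.11).  Count-neutral; N05 ∕ N06 NOT discharged; K1⁷ `stmt-QuantumFields-20542` NOT closed; one finite `𝕋⁴`
programme at fixed `ε`, Bałaban as printed; R4 closes only the conditional finite-`𝕋⁴` rung `BalabanLadder.UV` — nothing continuum ∕ ℝ⁴ ∕ OS ∕ mass
gap ∕ Clay.  Unit `pub-ymgap-dag-n06-w4` (g2), 2026-08-28.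
-/

noncomputable section

namespace Literature.MathematicalPhysics.QuantumFieldTheory.Balaban1983to89.B9SupplySockB9P3ZdGenuineGop

open B7Prop1Explicit B7Eq78Linearization
open B7Prop2Explicit (unitaryUnits)
open B8Ineq132 (BondTouches covDerivFwd)
open B8Eq155JBound (Jcur)
open B8Eq138LandauZd (covDivB)
open B8LeafModelZd (ZdIdx)
open B9SupplySockB9P3ZdLetters (OpsZd deltaAOf)
open B9SupplySockB9P3ZdLettersOmega (OnDom restrictDom Margin2)
open B9SupplySockB9P3ZdAt (DictAt Prop6At InvAt GopAddAt LandauAt)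
open B9SupplySockB9P3ZdBeta (SockB9P3D4β)
open B9SupplySockB9P3ZdGamma (SeesDom AvgAtγ)
open B9SupplySockB9P3ZdGammaInAk (CurvAtInAk sockB9P3D4γI_at)
open B9SupplySockB9P3ZdGammaInAkDpZd (withDpZd curvAtInAk_of_Dp_eq)
open B9Eq369CurvSmallZd (DpZd DpZd_add DpZd_smul)
open B9Eq321LandauProjectionZd (suppSub formE projE projR opsLandau indicator_mem_suppSub landauAt_opsLandau opsLandau_DRDs_of_finite)
open B9Eq326GaugeTermSquareZd (sum_finsum_re_trace_Jcur_nonneg finsum_re_trace_bond_DRD_eq_formE_sq finsum_re_trace_bond_DRD_nonneg)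
open B9Eq327GreenZd (domSub withGopZd gopZd RegularAt RegularInClassAt LinearOnDomAt bondPair gopAddAt_withGopZd invAt_withGopZd
  regularAt_of_bondPair_pos bondPair_deltaAOf_eq_four_terms support_finite_of_mem_domSub Jcur_smul_real)

-- `Site` alone could resolve to the torus sites of `Setup.lean`; re-export the `ℤ^d` sites of `B7Prop1Explicit`.
export B7Prop1Explicit (Site)

variable {d : ℕ} {𝔸 : Type*} [CStarAlgebra 𝔸] (τ : 𝔸 →ₗ[ℂ] ℂ) {L : ℕ}

/-! ## §1 The three-letter composite record -/

/-- **THE RECORD WITH THREE GENUINE LETTERS**: `ops₀` with `Dp := Δ′` (dag-n06-w2's `DpZd`), `DRDs := D R(U₀) 𝟙_{Ω₀}D*` (`opsLandau τ`), and THEN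
`Gop := (Ω₀Δ_aΩ₀)⁻¹` (`withGopZd`) — so that `G(U₀)` inverts `Ω₀(D*D + Δ′ + DRD* + Q*aQ)Ω₀` with the genuine `Δ′`, `DRD*` and `ops₀`'s `Q*aQ`.
[cite: Balaban1985BackgroundPropagators, (3.26)–(3.27) p.395, (3.10) p.392] -/
def opsGenuine (ops₀ : ℝ → ZdIdx d L → ℕ → OpsZd d 𝔸) : ℝ → ZdIdx d L → ℕ → OpsZd d 𝔸 :=
  withGopZd (opsLandau τ (withDpZd ops₀))

variable (ops₀ : ℝ → ZdIdx d L → ℕ → OpsZd d 𝔸) (M : ℝ) (i : ZdIdx d L) (m : ℕ)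

/-- the `Dp` field of the composite is the genuine `Δ′`. [cite: Balaban1985BackgroundPropagators, (3.10) p.392] -/
theorem opsGenuine_Dp : (opsGenuine τ ops₀ M i m).Dp = DpZd i.η := rfl

/-- the `DRDs` field of the composite is `opsLandau`'s genuine `D R(U₀) 𝟙_{Ω₀}D*`. [cite: Balaban1985BackgroundPropagators, (3.26) p.395] -/
theorem opsGenuine_DRDs : (opsGenuine τ ops₀ M i m).DRDs = (opsLandau τ (withDpZd ops₀) M i m).DRDs := rfl

/-- the `QQ` field of the composite is `ops₀`'s letter. [cite: Balaban1985BackgroundPropagators, (3.16) p.393] -/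
theorem opsGenuine_QQ : (opsGenuine τ ops₀ M i m).QQ = (ops₀ M i m).QQ := rfl

/-- the `Gop` field of the composite is the genuine `G(U₀)` over the genuine co-letters. [cite: Balaban1985BackgroundPropagators, (3.27) p.395] -/
theorem opsGenuine_Gop (U₀ : Site d → Fin d → 𝔸ˣ) (J : Site d → Fin d → 𝔸) :
    (opsGenuine τ ops₀ M i m).Gop U₀ J = gopZd i.η (opsLandau τ (withDpZd ops₀) M i m) (i.Ω 0) U₀ J := rfl

/-- `Δ_a` of the composite is `Δ_a` of the two-letter composite (`Gop` is not read). [cite: Balaban1985BackgroundPropagators, (3.26) p.395] -/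
theorem deltaAOf_opsGenuine (U₀ : Site d → Fin d → 𝔸ˣ) (A : Site d → Fin d → 𝔸) :
    deltaAOf i.η (opsGenuine τ ops₀ M i m) U₀ A = deltaAOf i.η (opsLandau τ (withDpZd ops₀) M i m) U₀ A := rfl

/-- **`G(U₀)` IS ALSO A RIGHT INVERSE ON `Ω₀`: `Ω₀Δ_a(U₀)(G(U₀)J) = Ω₀J`** in Theorem 3.11's regime (`RegularAt`) — print's `G = (Ω₀Δ_aΩ₀)⁻¹` is
two-sided: `A := G(U₀)J` SOLVES `Δ_a(U₀)A = J` on the bonds of `Ω₀` (the direction B8 (1.58) «A = G(U₀)J + …» uses), for ANY letter record `o`.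
[cite: Balaban1985BackgroundPropagators, (3.27) p.395; Balaban1985RegularSpaces, (1.58) p.86] -/
theorem restrictDom_deltaAOf_gopZd (η : ℝ) (o : OpsZd d 𝔸) (Ω₀ : Set (Site d)) (U₀ : Site d → Fin d → 𝔸ˣ) (h : RegularAt η o Ω₀ U₀)
    (J : Site d → Fin d → 𝔸) : restrictDom Ω₀ (deltaAOf η o U₀ (gopZd η o Ω₀ U₀ J)) = restrictDom Ω₀ J := by
  rw [B9Eq327GreenZd.gopZd_of_regularAt η o Ω₀ U₀ h, ← B9Eq327GreenZd.deltaADom, ← B9Eq327GreenZd.deltaAEquiv_coe η o Ω₀ U₀ h,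
    LinearEquiv.apply_symm_apply]
  rfl

/-- the same for the composite: `Ω₀Δ_a(U₀)(G(U₀)J) = Ω₀J` with the genuine `Δ′`, `D R D*` (and `ops₀`'s `Q*aQ`), in the regime.
[cite: Balaban1985BackgroundPropagators, (3.27) p.395] -/
theorem restrictDom_deltaAOf_opsGenuine_gop (U₀ : Site d → Fin d → 𝔸ˣ) (h : RegularAt i.η (opsLandau τ (withDpZd ops₀) M i m) (i.Ω 0) U₀)
    (J : Site d → Fin d → 𝔸) :
    restrictDom (i.Ω 0) (deltaAOf i.η (opsGenuine τ ops₀ M i m) U₀ ((opsGenuine τ ops₀ M i m).Gop U₀ J)) = restrictDom (i.Ω 0) J :=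
  restrictDom_deltaAOf_gopZd i.η (opsLandau τ (withDpZd ops₀) M i m) (i.Ω 0) U₀ h J

/-! ## §2 The three object-borne binders hold at once, unconditionally -/

/-- ★★ **`CurvAtInAk` AT THE COMPOSITE** (`1 ≤ L`, `1 ≤ M`; any `τ`): dag-n06-w2's `curvAtInAk_of_Dp_eq` — the `Dp` field is `DpZd` by `rfl`.
[cite: Balaban1985BackgroundPropagators, (3.69) p.404; Balaban1985RegularSpaces, (1.7) p.77] -/
theorem curvAtInAk_opsGenuine [Nontrivial 𝔸] (hL : 1 ≤ L) {M : ℝ} (hM : 1 ≤ M) (i : ZdIdx d L) (m : ℕ) :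
    CurvAtInAk L (opsGenuine τ ops₀) (14 * ((d - 1 : ℕ) : ℝ)) M i m :=
  curvAtInAk_of_Dp_eq hL (fun M i m => opsGenuine_Dp τ ops₀ M i m) hM i m

variable {I : Type} (bg : I → B9.Backgrounds) (mem : ℝ → ZdIdx d L → ℕ → I)
variable (ιCfg : ∀ (M : ℝ) (i : ZdIdx d L) (m : ℕ) (U₀ : Site d → Fin d → 𝔸ˣ),
  (∀ x κ, U₀ x κ ∈ unitaryUnits 𝔸) → (bg (mem M i m)).Cfg)

/-- ★★ **`LandauAt` AT THE COMPOSITE** (members with finite `Ω₀`; `τ` tracial, Hermitian, faithful; `𝔸` finite-dimensional): this seat's `landauAt_opsLandau`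
at `ops₀ := withDpZd ops₀` — the binder reads only the `DRDs` field, which `withGopZd` leaves untouched.
[cite: Balaban1985BackgroundPropagators, (3.20)–(3.22) p.394, (3.26) p.395; Balaban1985RegularSpaces, (1.42) p.83, (1.58) p.86] -/
theorem landauAt_opsGenuine [NeZero L] [FiniteDimensional ℝ 𝔸] (hτt : ∀ a b : 𝔸, τ (a * b) = τ (b * a))
    (hτs : ∀ a : 𝔸, τ (star a) = starRingEnd ℂ (τ a)) (hτp : ∀ a : 𝔸, a ≠ 0 → 0 < (τ (star a * a)).re)
    (c35 a₃ : ℝ) (hΩ : (i.Ω 0).Finite) :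
    LandauAt bg L mem ιCfg (opsGenuine τ ops₀) c35 a₃ M i m := by
  intro α₀ U₀ hU₀ hα hMα hR A hA hL x μ
  exact landauAt_opsLandau τ hτt hτs hτp (withDpZd ops₀) bg mem ιCfg c35 a₃ M i m hΩ α₀ U₀ hU₀ hα hMα hR A hA hL x μ

/-- ★★ **`GopAddAt` AT THE COMPOSITE, NO HYPOTHESIS** (`B9Eq327GreenZd.gopAddAt_withGopZd`). [cite: Balaban1985BackgroundPropagators, (3.27) p.395] -/
theorem gopAddAt_opsGenuine : GopAddAt L (opsGenuine τ ops₀) M i m :=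
  gopAddAt_withGopZd (opsLandau τ (withDpZd ops₀)) M i m

/-- ★ **THREE OBJECT-BORNE BINDERS AT ONCE** at the composite record (finite `Ω₀`, `1 ≤ L`, `1 ≤ M`, the `τ`-hypotheses): `CurvAtInAk ∧ LandauAt ∧ GopAddAt`.
[cite: Balaban1985BackgroundPropagators, (3.69) p.404, (3.20)–(3.27) pp.394–395; Balaban1985RegularSpaces, (1.7) p.77, (1.42) p.83] -/
theorem three_binders_opsGenuine [Nontrivial 𝔸] [NeZero L] [FiniteDimensional ℝ 𝔸] (hL : 1 ≤ L)
    (hτt : ∀ a b : 𝔸, τ (a * b) = τ (b * a)) (hτs : ∀ a : 𝔸, τ (star a) = starRingEnd ℂ (τ a))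
    (hτp : ∀ a : 𝔸, a ≠ 0 → 0 < (τ (star a * a)).re) (c35 a₃ : ℝ) {M : ℝ} (hM : 1 ≤ M) (i : ZdIdx d L) (m : ℕ) (hΩ : (i.Ω 0).Finite) :
    CurvAtInAk L (opsGenuine τ ops₀) (14 * ((d - 1 : ℕ) : ℝ)) M i m ∧ LandauAt bg L mem ιCfg (opsGenuine τ ops₀) c35 a₃ M i m ∧
      GopAddAt L (opsGenuine τ ops₀) M i m :=
  ⟨curvAtInAk_opsGenuine τ ops₀ hL hM i m, landauAt_opsGenuine τ ops₀ M i m bg mem ιCfg hτt hτs hτp c35 a₃ hΩ,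
    gopAddAt_opsGenuine τ ops₀ M i m⟩

/-! ## §3 The genuine letters are ℝ-linear in `A`; `LinearOnDomAt` for the composite -/

section Linear

variable {τ}

omit [CStarAlgebra 𝔸] in
/-- the forward covariant derivative is ℝ-homogeneous. [cite: Balaban1985RegularSpaces, (1.1) p.76] -/
private theorem covDerivFwd_smul_real {𝔸 : Type*} [NormedRing 𝔸] [NormedAlgebra ℂ 𝔸] (η : ℝ) (U₀ : Site d → Fin d → 𝔸ˣ) (μ : Fin d) (c : ℝ)
    (F : Site d → 𝔸) (x : Site d) : covDerivFwd η U₀ μ (c • F) x = c • covDerivFwd η U₀ μ F x := by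
  simp only [covDerivFwd, Pi.smul_apply, conjR_smul_real, ← smul_sub, smul_comm c]

/-- the backward covariant derivative is ℝ-homogeneous. [cite: Balaban1985RegularSpaces, (1.1) p.76] -/
private theorem covDeriv_smul_real (η : ℝ) (U₀ : Site d → Fin d → 𝔸ˣ) (ν : Fin d) (c : ℝ) (F : Site d → 𝔸) (x : Site d) :
    B8Ineq132.covDeriv η U₀ ν (c • F) x = c • B8Ineq132.covDeriv η U₀ ν F x := by
  simp only [B8Ineq132.covDeriv, Pi.smul_apply, conjR_smul_real, ← smul_sub, smul_comm c]

/-- the covariant divergence is ℝ-homogeneous in the bond field. [cite: Balaban1985RegularSpaces, (1.1) p.76] -/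
private theorem covDivB_smul_real (η : ℝ) (U₀ : Site d → Fin d → 𝔸ˣ) (c : ℝ) (A : Site d → Fin d → 𝔸) (x : Site d) :
    covDivB η U₀ (c • A) x = c • covDivB η U₀ A x := by
  simp only [covDivB, Finset.smul_sum]
  refine Finset.sum_congr rfl fun μ _ => ?_
  have h : (fun z => (c • A) z μ) = c • fun z => A z μ := rfl
  rw [h, covDeriv_smul_real]

variable (τ : 𝔸 →ₗ[ℂ] ℂ) (s : Finset (Site d)) (L m : ℕ) (η : ℝ) (Λs : ℕ → Set (Site d)) (U₀ : Site d → Fin d → 𝔸ˣ)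

/-- **THE CONSTRUCTED `R(U₀)` IS ADDITIVE ON FUNCTIONS** (`projR` = restrict to `Ω₀`, apply the linear `projE`, read back).
[cite: Balaban1985BackgroundPropagators, (3.21)–(3.22) p.394] -/
theorem projR_add (f g : Site d → 𝔸) : projR τ s L m η Λs U₀ (f + g) = projR τ s L m η Λs U₀ f + projR τ s L m η Λs U₀ g := by
  have h : (⟨(↑s : Set (Site d)).indicator (f + g), indicator_mem_suppSub s _⟩ : suppSub (𝔸 := 𝔸) s) =
      ⟨(↑s : Set (Site d)).indicator f, indicator_mem_suppSub s f⟩ + ⟨(↑s : Set (Site d)).indicator g, indicator_mem_suppSub s g⟩ :=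
    Subtype.ext (Set.indicator_add _ f g)
  rw [projR, h, map_add]
  rfl

/-- **THE CONSTRUCTED `R(U₀)` IS ℝ-HOMOGENEOUS ON FUNCTIONS.** [cite: Balaban1985BackgroundPropagators, (3.21)–(3.22) p.394] -/
theorem projR_smul (c : ℝ) (f : Site d → 𝔸) : projR τ s L m η Λs U₀ (c • f) = c • projR τ s L m η Λs U₀ f := by
  have h : (⟨(↑s : Set (Site d)).indicator (c • f), indicator_mem_suppSub s _⟩ : suppSub (𝔸 := 𝔸) s) =
      c • ⟨(↑s : Set (Site d)).indicator f, indicator_mem_suppSub s f⟩ :=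
    Subtype.ext (Set.indicator_const_smul _ c f)
  rw [projR, h, map_smul]
  rfl

variable {s L m η Λs U₀}

/-- ★ **THE GENUINE `D R(U₀) 𝟙_{Ω₀}D*` IS ADDITIVE IN `A`** at a member with finite `Ω₀`. [cite: Balaban1985BackgroundPropagators, (3.26) p.395] -/
theorem opsLandau_DRDs_add (ops : ℝ → ZdIdx d L → ℕ → OpsZd d 𝔸) (M : ℝ) (i : ZdIdx d L) (m : ℕ) (hΩ : (i.Ω 0).Finite)
    (U₀ : Site d → Fin d → 𝔸ˣ) (A B : Site d → Fin d → 𝔸) :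
    (opsLandau τ ops M i m).DRDs U₀ (A + B) = (opsLandau τ ops M i m).DRDs U₀ A + (opsLandau τ ops M i m).DRDs U₀ B := by
  funext x μ
  rw [Pi.add_apply, Pi.add_apply, opsLandau_DRDs_of_finite τ ops M i m hΩ, opsLandau_DRDs_of_finite τ ops M i m hΩ,
    opsLandau_DRDs_of_finite τ ops M i m hΩ]
  have hdiv : covDivB i.η U₀ (A + B) = covDivB i.η U₀ A + covDivB i.η U₀ B :=
    funext fun x => B9SupplySockB9P3ZdLettersOmega.covDivB_add i.η U₀ A B x
  rw [hdiv, projR_add, B8LambdaSpaceKLevel.covDerivFwd_add']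

/-- ★ **THE GENUINE `D R(U₀) 𝟙_{Ω₀}D*` IS ℝ-HOMOGENEOUS IN `A`** at a member with finite `Ω₀`. [cite: Balaban1985BackgroundPropagators, (3.26) p.395] -/
theorem opsLandau_DRDs_smul (ops : ℝ → ZdIdx d L → ℕ → OpsZd d 𝔸) (M : ℝ) (i : ZdIdx d L) (m : ℕ) (hΩ : (i.Ω 0).Finite)
    (U₀ : Site d → Fin d → 𝔸ˣ) (c : ℝ) (A : Site d → Fin d → 𝔸) :
    (opsLandau τ ops M i m).DRDs U₀ (c • A) = c • (opsLandau τ ops M i m).DRDs U₀ A := by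
  funext x μ
  rw [Pi.smul_apply, Pi.smul_apply, opsLandau_DRDs_of_finite τ ops M i m hΩ, opsLandau_DRDs_of_finite τ ops M i m hΩ]
  have hdiv : covDivB i.η U₀ (c • A) = c • covDivB i.η U₀ A := funext fun x => covDivB_smul_real i.η U₀ c A x
  rw [hdiv, projR_smul, covDerivFwd_smul_real]

/-- the genuine `Δ′` is ℝ-homogeneous (dag-n06-w2's `DpZd_smul` at a real scalar). [cite: Balaban1985BackgroundPropagators, (3.10) p.392] -/
private theorem DpZd_smul_real (η : ℝ) (U₀ : Site d → Fin d → 𝔸ˣ) (c : ℝ) (A : Site d → Fin d → 𝔸) : DpZd η U₀ (c • A) = c • DpZd η U₀ A := by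
  rw [← Complex.coe_smul, DpZd_smul, Complex.coe_smul]

/-- **THE DISPLAYED HYPOTHESIS ON THE `Q*aQ` LETTER**: at the background `U₀` the record's `QQ U₀` is the restriction of an ℝ-linear map of bond fields
(true for print's (3.16), a quadratic form of the linear `Q_j(U)`; the genuine `QQ` is the successor's object). [cite: Balaban1985BackgroundPropagators, (3.16) p.393] -/
def QQLinearAt (o : OpsZd d 𝔸) (U₀ : Site d → Fin d → 𝔸ˣ) : Prop :=
  ∃ T : (Site d → Fin d → 𝔸) →ₗ[ℝ] (Site d → Fin d → 𝔸), ∀ A, T A = o.QQ U₀ A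

/-- ★★ **`Δ_a(U₀)` OF THE COMPOSITE IS ℝ-LINEAR** (members with finite `Ω₀`): `D*D` (B8's current, `Jcur_add` ∕ `Jcur_smul_real`), the genuine `Δ′`
(`DpZd_add ∕ _smul`), the genuine `D R D*` (§3) are linear; with the `Q*aQ` letter linear at `U₀` (`QQLinearAt`), `LinearOnDomAt` holds (indeed on all bond
fields). [cite: Balaban1985BackgroundPropagators, (3.26) p.395] -/
theorem linearOnDomAt_opsGenuine (ops₀ : ℝ → ZdIdx d L → ℕ → OpsZd d 𝔸) (M : ℝ) (i : ZdIdx d L) (m : ℕ) (hΩ : (i.Ω 0).Finite)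
    (U₀ : Site d → Fin d → 𝔸ˣ) (hQ : QQLinearAt (ops₀ M i m) U₀) :
    LinearOnDomAt i.η (opsGenuine τ ops₀ M i m) (i.Ω 0) U₀ := by
  obtain ⟨Tq, hTq⟩ := hQ
  -- the three linear pieces besides `Q*aQ`
  let TJ : (Site d → Fin d → 𝔸) →ₗ[ℝ] (Site d → Fin d → 𝔸) :=
    { toFun := fun A x μ => Jcur i.η U₀ A μ x
      map_add' := fun A B => by
        funext x μ
        exact B9SupplySockB9P3ZdLettersOmega.Jcur_add i.η U₀ A B μ x
      map_smul' := fun c A => by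
        funext x μ
        exact Jcur_smul_real i.η U₀ c A μ x }
  let TD : (Site d → Fin d → 𝔸) →ₗ[ℝ] (Site d → Fin d → 𝔸) :=
    { toFun := fun A => DpZd i.η U₀ A
      map_add' := fun A B => DpZd_add i.η U₀ A B
      map_smul' := fun c A => DpZd_smul_real i.η U₀ c A }
  let TR : (Site d → Fin d → 𝔸) →ₗ[ℝ] (Site d → Fin d → 𝔸) :=
    { toFun := fun A => (opsLandau τ (withDpZd ops₀) M i m).DRDs U₀ A
      map_add' := fun A B => opsLandau_DRDs_add τ (withDpZd ops₀) M i m hΩ U₀ A B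
      map_smul' := fun c A => opsLandau_DRDs_smul τ (withDpZd ops₀) M i m hΩ U₀ c A }
  refine ⟨TJ + TD + TR + Tq, fun A _ => ?_⟩
  funext x μ
  simp only [LinearMap.add_apply, Pi.add_apply, hTq A]
  rfl

end Linear

/-! ## §4 Theorem 3.11 at the member in print's currency (positivity of `⟨A, Δ_a(U₀)A⟩`) ⟹ `InvAt` for the composite -/

section Positivity

variable {I : Type} (bg : I → B9.Backgrounds) (mem : ℝ → ZdIdx d L → ℕ → I)
variable (ιCfg : ∀ (M : ℝ) (i : ZdIdx d L) (m : ℕ) (U₀ : Site d → Fin d → 𝔸ˣ),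
  (∀ x κ, U₀ x κ ∈ unitaryUnits 𝔸) → (bg (mem M i m)).Cfg)

/-- **THEOREM 3.11 AT THE MEMBER `(M, i, m)`, IN PRINT'S CURRENCY** («for U satisfying (3.35) the operators … Δ_a, G are positive definite»): for the
record `ops` and the trace parameter `τ`, at every unitary background `U₀` of the member's class (3.35) with `0 < α₀`, `Mα₀ ≤ a₃` — the guards of
`B9SupplySockB9P3ZdAt.InvAt` verbatim — the pairing `⟨A, Δ_a(U₀)A⟩_τ` is positive for every `0 ≠ A ∈ E(Ω₀)`.  A `Prop` the consumer supplies — NOT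
proved here ([4] Sect. E). [cite: Balaban1985BackgroundPropagators, Thm 3.11 p.416, (3.35) p.396, (3.26) p.395] -/
def PosDefInClassAt (ops : ℝ → ZdIdx d L → ℕ → OpsZd d 𝔸) (c35 a₃ : ℝ) (M : ℝ) (i : ZdIdx d L) (m : ℕ) : Prop :=
  ∀ (α₀ : ℝ) (U₀ : Site d → Fin d → 𝔸ˣ) (hU₀ : ∀ x κ, U₀ x κ ∈ unitaryUnits 𝔸), 0 < α₀ → M * α₀ ≤ a₃ →
    (bg (mem M i m)).Reg335 c35 α₀ (ιCfg M i m U₀ hU₀) →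
    ∀ A ∈ domSub (𝔸 := 𝔸) (i.Ω 0), A ≠ 0 → 0 < bondPair τ A (deltaAOf i.η (ops M i m) U₀ A)

/-- **THE `Q*aQ` LETTER IS LINEAR ON THE CLASS** (the displayed hypothesis on `ops₀`, with the guards of `InvAt`). [cite: Balaban1985BackgroundPropagators, (3.16) p.393] -/
def QQLinearInClassAt (ops : ℝ → ZdIdx d L → ℕ → OpsZd d 𝔸) (c35 a₃ : ℝ) (M : ℝ) (i : ZdIdx d L) (m : ℕ) : Prop :=
  ∀ (α₀ : ℝ) (U₀ : Site d → Fin d → 𝔸ˣ) (hU₀ : ∀ x κ, U₀ x κ ∈ unitaryUnits 𝔸), 0 < α₀ → M * α₀ ≤ a₃ →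
    (bg (mem M i m)).Reg335 c35 α₀ (ιCfg M i m U₀ hU₀) → QQLinearAt (ops M i m) U₀

/-- ★★ **THEOREM 3.11 (PRINT'S CURRENCY) ⟹ `RegularInClassAt` FOR THE COMPOSITE** (finite `Ω₀`, finite-dimensional `𝔸`): positivity of
`⟨A, Δ_a(U₀)A⟩_τ` on `E(Ω₀) ∖ 0` plus linearity give the invertibility of `Ω₀Δ_a(U₀)Ω₀` on `E(Ω₀)` at every `U₀` of the class
(`B9Eq327GreenZd.regularAt_of_bondPair_pos`). [cite: Balaban1985BackgroundPropagators, Thm 3.11 p.416, (3.27) p.395] -/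
theorem regularInClassAt_opsGenuine_of_posDef [FiniteDimensional ℝ 𝔸] (ops₀ : ℝ → ZdIdx d L → ℕ → OpsZd d 𝔸) (c35 a₃ M : ℝ) (i : ZdIdx d L)
    (m : ℕ) (hΩ : (i.Ω 0).Finite) (hQ : QQLinearInClassAt bg mem ιCfg ops₀ c35 a₃ M i m)
    (hpos : PosDefInClassAt τ bg mem ιCfg (opsGenuine τ ops₀) c35 a₃ M i m) :
    RegularInClassAt bg mem ιCfg (opsLandau τ (withDpZd ops₀)) c35 a₃ M i m := by
  intro α₀ U₀ hU₀ hα hMα hR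
  exact regularAt_of_bondPair_pos τ hΩ (linearOnDomAt_opsGenuine τ ops₀ M i m hΩ U₀ (hQ α₀ U₀ hU₀ hα hMα hR))
    fun A hA hA0 => hpos α₀ U₀ hU₀ hα hMα hR A hA hA0

/-- ★★★ **THE BINDER `InvAt` FOR THE THREE-LETTER COMPOSITE, FROM THEOREM 3.11 AT THE MEMBER IN PRINT'S CURRENCY**: finite `Ω₀`, finite-dimensional
`𝔸`; if `⟨A, Δ_a(U₀)A⟩_τ > 0` on `E(Ω₀) ∖ 0` and the `Q*aQ` letter is linear, for every unitary `U₀` of the member's class (3.35), then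
`B9SupplySockB9P3ZdAt.InvAt bg L mem ιCfg (opsGenuine τ ops₀) c35 a₃ M i m` — `G(U₀)(Δ_a(U₀)A) = A` on `E(Ω₀)` for the genuine `G`, `Δ′`, `D R D*`.
[cite: Balaban1985BackgroundPropagators, (3.27) p.395, Thm 3.11 p.416; Balaban1985RegularSpaces, (1.58) p.86] -/
theorem invAt_opsGenuine_of_posDef [FiniteDimensional ℝ 𝔸] (ops₀ : ℝ → ZdIdx d L → ℕ → OpsZd d 𝔸) (c35 a₃ M : ℝ) (i : ZdIdx d L) (m : ℕ)
    (hΩ : (i.Ω 0).Finite) (hQ : QQLinearInClassAt bg mem ιCfg ops₀ c35 a₃ M i m)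
    (hpos : PosDefInClassAt τ bg mem ιCfg (opsGenuine τ ops₀) c35 a₃ M i m) :
    InvAt bg L mem ιCfg (opsGenuine τ ops₀) c35 a₃ M i m :=
  invAt_withGopZd (opsLandau τ (withDpZd ops₀)) M i m bg mem ιCfg c35 a₃
    (regularInClassAt_opsGenuine_of_posDef τ bg mem ιCfg ops₀ c35 a₃ M i m hΩ hQ hpos)

/-- ★ **ALL FOUR OBJECT-BORNE BINDERS OF THE COMPOSITE** (finite `Ω₀`, `1 ≤ L`, `1 ≤ M`, finite-dimensional `𝔸`, the `τ`-hypotheses): `CurvAtInAk`,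
`LandauAt`, `GopAddAt` unconditionally, and `InvAt` under Theorem 3.11 at the member (print's currency) + linearity of the `Q*aQ` letter.
[cite: Balaban1985BackgroundPropagators, (3.69) p.404, (3.20)–(3.27) pp.394–395, Thm 3.11 p.416; Balaban1985RegularSpaces, (1.58) p.86] -/
theorem all_object_binders_opsGenuine [Nontrivial 𝔸] [NeZero L] [FiniteDimensional ℝ 𝔸] (hL : 1 ≤ L)
    (hτt : ∀ a b : 𝔸, τ (a * b) = τ (b * a)) (hτs : ∀ a : 𝔸, τ (star a) = starRingEnd ℂ (τ a))
    (hτp : ∀ a : 𝔸, a ≠ 0 → 0 < (τ (star a * a)).re) (ops₀ : ℝ → ZdIdx d L → ℕ → OpsZd d 𝔸) (c35 a₃ : ℝ) {M : ℝ} (hM : 1 ≤ M)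
    (i : ZdIdx d L) (m : ℕ) (hΩ : (i.Ω 0).Finite) (hQ : QQLinearInClassAt bg mem ιCfg ops₀ c35 a₃ M i m)
    (hpos : PosDefInClassAt τ bg mem ιCfg (opsGenuine τ ops₀) c35 a₃ M i m) :
    CurvAtInAk L (opsGenuine τ ops₀) (14 * ((d - 1 : ℕ) : ℝ)) M i m ∧ LandauAt bg L mem ιCfg (opsGenuine τ ops₀) c35 a₃ M i m ∧
      GopAddAt L (opsGenuine τ ops₀) M i m ∧ InvAt bg L mem ιCfg (opsGenuine τ ops₀) c35 a₃ M i m :=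
  ⟨curvAtInAk_opsGenuine τ ops₀ hL hM i m, landauAt_opsGenuine τ ops₀ M i m bg mem ιCfg hτt hτs hτp c35 a₃ hΩ,
    gopAddAt_opsGenuine τ ops₀ M i m, invAt_opsGenuine_of_posDef τ bg mem ιCfg ops₀ c35 a₃ M i m hΩ hQ hpos⟩

end Positivity

/-! ## §5 The ledger of Theorem 3.11's positivity at the carrier: two of the four summands are squares -/

section Ledger

variable (ops₀ : ℝ → ZdIdx d L → ℕ → OpsZd d 𝔸) (M : ℝ) (i : ZdIdx d L) (m : ℕ)

/-- ★★ **`⟨A, Δ_a(U₀)A⟩_τ ≥ ⟨A, Δ′(U₀)A⟩_τ + ⟨A, Q*aQ A⟩_τ` FOR THE COMPOSITE AT A UNITARY BACKGROUND** (finite `Ω₀`, `A ∈ E(Ω₀)`; `τ` tracial,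
Hermitian, faithful; `𝔸` finite-dimensional): of the four summands of (3.26) with (3.10), `⟨A, D*DA⟩ ≥ 0` (`sum_finsum_re_trace_Jcur_nonneg`) and
`⟨A, D R(U₀) 𝟙_{Ω₀}D* A⟩ = ‖R(U₀)𝟙_{Ω₀}D^{η*}_{U₀}A‖² ≥ 0` (`finsum_re_trace_bond_DRD_nonneg`, p591149) are dropped — what Theorem 3.11 must supply at the
carrier is the domination of the (unsigned, (3.69)-small) curvature term by the other three. [cite: Balaban1985BackgroundPropagators, Thm 3.11 p.416, (3.26) p.395, (3.10) p.392, (3.69) p.404] -/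
theorem bondPair_deltaAOf_opsGenuine_ge [FiniteDimensional ℝ 𝔸] (hτt : ∀ a b : 𝔸, τ (a * b) = τ (b * a))
    (hτs : ∀ a : 𝔸, τ (star a) = starRingEnd ℂ (τ a)) (hτp : ∀ a : 𝔸, a ≠ 0 → 0 < (τ (star a * a)).re) (hΩ : (i.Ω 0).Finite)
    {U₀ : Site d → Fin d → 𝔸ˣ} (hU : ∀ (x : Site d) (κ : Fin d), U₀ x κ ∈ unitaryUnits 𝔸)
    {A : Site d → Fin d → 𝔸} (hA : A ∈ domSub (𝔸 := 𝔸) (i.Ω 0)) :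
    bondPair τ A (DpZd i.η U₀ A) + bondPair τ A ((ops₀ M i m).QQ U₀ A) ≤ bondPair τ A (deltaAOf i.η (opsGenuine τ ops₀ M i m) U₀ A) := by
  have hfin := support_finite_of_mem_domSub hΩ hA
  rw [bondPair_deltaAOf_eq_four_terms τ i.η (opsGenuine τ ops₀ M i m) U₀ hfin]
  have h1 : 0 ≤ ∑ μ : Fin d, ∑ᶠ x, (τ (star (A x μ) * Jcur i.η U₀ A μ x)).re := sum_finsum_re_trace_Jcur_nonneg i.η hτt hτp hU hfin
  have h3 : 0 ≤ bondPair τ A ((opsGenuine τ ops₀ M i m).DRDs U₀ A) := by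
    rw [bondPair, opsGenuine_DRDs]
    simp only [opsLandau_DRDs_of_finite τ (withDpZd ops₀) M i m hΩ]
    exact finsum_re_trace_bond_DRD_nonneg hτt hτs hτp hU hfin
  have h2 : bondPair τ A ((opsGenuine τ ops₀ M i m).Dp U₀ A) = bondPair τ A (DpZd i.η U₀ A) := rfl
  have h4 : bondPair τ A ((opsGenuine τ ops₀ M i m).QQ U₀ A) = bondPair τ A ((ops₀ M i m).QQ U₀ A) := rfl
  rw [h2, h4]
  linarith

variable {I : Type} (bg : I → B9.Backgrounds) (mem : ℝ → ZdIdx d L → ℕ → I)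
variable (ιCfg : ∀ (M : ℝ) (i : ZdIdx d L) (m : ℕ) (U₀ : Site d → Fin d → 𝔸ˣ),
  (∀ x κ, U₀ x κ ∈ unitaryUnits 𝔸) → (bg (mem M i m)).Cfg)

/-- ★ **REDUCTION OF THEOREM 3.11 AT THE CARRIER TO THE CURVATURE TERM**: if, at every unitary `U₀` of the member's class and every `0 ≠ A ∈ E(Ω₀)`,
`⟨A, Δ′(U₀)A⟩_τ + ⟨A, Q*aQ A⟩_τ > 0` — OR more generally the curvature term is dominated by the three non-negative ones, which is what print proves —
then `PosDefInClassAt` holds for the composite; stated in the simplest sufficient form (`0 < ⟨A, Δ′A⟩ + ⟨A, Q*aQA⟩`), bookkeeping over §5's inequality.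
[cite: Balaban1985BackgroundPropagators, Thm 3.11 p.416, (3.69) p.404, (3.26) p.395] -/
theorem posDefInClassAt_opsGenuine_of_curv [FiniteDimensional ℝ 𝔸] (hτt : ∀ a b : 𝔸, τ (a * b) = τ (b * a))
    (hτs : ∀ a : 𝔸, τ (star a) = starRingEnd ℂ (τ a)) (hτp : ∀ a : 𝔸, a ≠ 0 → 0 < (τ (star a * a)).re) (c35 a₃ : ℝ)
    (hΩ : (i.Ω 0).Finite)
    (hcurv : ∀ (α₀ : ℝ) (U₀ : Site d → Fin d → 𝔸ˣ) (hU₀ : ∀ x κ, U₀ x κ ∈ unitaryUnits 𝔸), 0 < α₀ → M * α₀ ≤ a₃ →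
      (bg (mem M i m)).Reg335 c35 α₀ (ιCfg M i m U₀ hU₀) →
      ∀ A ∈ domSub (𝔸 := 𝔸) (i.Ω 0), A ≠ 0 → 0 < bondPair τ A (DpZd i.η U₀ A) + bondPair τ A ((ops₀ M i m).QQ U₀ A)) :
    PosDefInClassAt τ bg mem ιCfg (opsGenuine τ ops₀) c35 a₃ M i m :=
  fun α₀ U₀ hU₀ hα hMα hR A hA hA0 =>
    lt_of_lt_of_le (hcurv α₀ U₀ hU₀ hα hMα hR A hA hA0) (bondPair_deltaAOf_opsGenuine_ge τ ops₀ M i m hτt hτs hτp hΩ hU₀ hA)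

end Ledger

/-! ## §6 For the consumer: the finite-`Ω₀` supplier with the three object-borne binders replaced by theorems -/

section Supplier

variable [Nontrivial 𝔸] [NeZero L] [FiniteDimensional ℝ 𝔸]
variable {I : Type} (geo : I → B9.Geometry) (bg : I → B9.Backgrounds) (GA : ∀ i, B9.KernelFamily (geo i) (bg i))
variable (mem : ℝ → ZdIdx d L → ℕ → I)
variable (ιCfg : ∀ (M : ℝ) (i : ZdIdx d L) (m : ℕ) (U₀ : Site d → Fin d → 𝔸ˣ),
  (∀ x κ, U₀ x κ ∈ unitaryUnits 𝔸) → (bg (mem M i m)).Cfg)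
variable (ιLoc : ∀ (M : ℝ) (i : ZdIdx d L) (m : ℕ), (Site d → Fin d → 𝔸) → (geo (mem M i m)).Loc)

/-- ★★ **THE J-N06→N05 SUPPLIER ON THE FINITE-`Ω₀` (MARGIN) ROAD FOR THE THREE-LETTER COMPOSITE** — dag-n06-b's `sockB9P3D4γI_at`
(`B9SupplySockB9P3ZdGammaInAk`, p585159) with its three letter-binders `InvAt`, `CurvAtInAk`, `LandauAt` REPLACED: `CurvAtInAk` and `LandauAt` are theorems
for `opsGenuine τ ops₀` (§2), and `InvAt` follows from THEOREM 3.11 AT THE MEMBER IN PRINT'S CURRENCY (`PosDefInClassAt`) plus the linearity of the `Q*aQ`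
letter (§4).  What the consumer still supplies: the norm dictionary `DictAt`, Prop. 6 `Prop6At`, the averaging binder `AvgAtγ` (the `QQ` letter's), the
locality law `SeesDom`, Theorem 3.3's local block `h33U` — and Theorem 3.11's positivity.  Constants as there, with `c69 := 14(d−1)`.
[cite: Balaban1985BackgroundPropagators, Thm 3.3 p.399, Thm 3.11 p.416, (3.27) p.395; Balaban1985RegularSpaces, (1.58)–(1.59) p.86] -/
theorem sockB9P3D4γI_at_opsGenuine (hd2 : 2 ≤ d) (hL : 1 ≤ L)
    (hτt : ∀ a b : 𝔸, τ (a * b) = τ (b * a)) (hτs : ∀ a : 𝔸, τ (star a) = starRingEnd ℂ (τ a))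
    (hτp : ∀ a : 𝔸, a ≠ 0 → 0 < (τ (star a * a)).re) (ops₀ : ℝ → ZdIdx d L → ℕ → OpsZd d 𝔸) {c35 c₆ K₆ a₃ q : ℝ}
    {M : ℝ} (hM1 : 1 ≤ M) (i : ZdIdx d L) (hMi : Margin2 i.Ω) (hΩ : (i.Ω 0).Finite) {m : ℕ}
    (hdict : DictAt geo bg GA L mem ιCfg ιLoc (opsGenuine τ ops₀) M i m) (hP6 : Prop6At bg L mem ιCfg c35 c₆ K₆ M i m)
    (hQ : QQLinearInClassAt bg mem ιCfg ops₀ c35 a₃ M i m) (hpos : PosDefInClassAt τ bg mem ιCfg (opsGenuine τ ops₀) c35 a₃ M i m)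
    (ΛbP : ℕ → ℕ → Set (Site d × Fin d)) (havg : AvgAtγ L (opsGenuine τ ops₀) q ΛbP M i m) (hsee : SeesDom L m (i.Ω 0) ΛbP)
    (hK₆ : 0 < K₆) (hq : 0 ≤ q) {B₀ δ₀ a₀ : ℝ} (hB₀ : 0 < B₀)
    (h33U : ∀ (α₀ : ℝ) (U₀ : Site d → Fin d → 𝔸ˣ) (hU₀ : ∀ x κ, U₀ x κ ∈ unitaryUnits 𝔸), 0 < α₀ → M * α₀ ≤ a₀ →
      (bg (mem M i m)).Reg335 c35 α₀ (ιCfg M i m U₀ hU₀) →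
      B9.Ineq342_346_347 (GA (mem M i m)) B₀ δ₀ (ιCfg M i m U₀ hU₀)) :
    SockB9P3D4β (𝔸 := 𝔸) L (max 1 (2 * B₀ * max 1 q)) ((20 * d + 2) * max 1 (2 * B₀ * max 1 q))
      (min (1 / 16) (min (c₆ / M) (min (a₀ / (K₆ * M)) (min (a₃ / (K₆ * M)) (1 / (2 * B₀ * (14 * ((d - 1 : ℕ) : ℝ)) * M + 1))))))
      i.η m i.Ω i.Λs ΛbP :=
  sockB9P3D4γI_at (geo := geo) (bg := bg) (GA := GA) (L := L) (mem := mem) (ιCfg := ιCfg) (ιLoc := ιLoc) (ops := opsGenuine τ ops₀)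
    hd2 hL hM1 i hMi hdict hP6 (invAt_opsGenuine_of_posDef τ bg mem ιCfg ops₀ c35 a₃ M i m hΩ hQ hpos)
    (curvAtInAk_opsGenuine τ ops₀ hL hM1 i m) (landauAt_opsGenuine τ ops₀ M i m bg mem ιCfg hτt hτs hτp c35 a₃ hΩ) ΛbP havg hsee hK₆
    (by positivity) hq hB₀ h33U

end Supplier

end Literature.MathematicalPhysics.QuantumFieldTheory.Balaban1983to89.B9SupplySockB9P3ZdGenuineGop

end
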